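import Summits.CriticalPhenomena.PercolationContinuityZ3.Theorems.Transplant.SkelTubeLevels
import Summits.CriticalPhenomena.PercolationContinuityZ3.Theorems.Transplant.KNCells2ChainAdv
import Summits.CriticalPhenomena.PercolationContinuityZ3.Theorems.Transplant.KNLevelsTargetChain
import HarnessLib

/-!
# L6.0d — the STRAIGHT-RUN chain over a `PlanarSkeletonConc` as target steps in a window graph (the ROOT PROBE chain of `hQ0` — outside the
# wired root cube, from a first fresh core in `Btw(0,du)` to `M_{du}` — and the ELONGATED inner routes of the face step; planar schedule =
# `ChainPlanar.Adv`): the packaging record `Skel.WinAdvData` (generic twin of p2's `BoxProdZ2.TubeAdvData`, KNCellsBoxProdZ2ChainTA) —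
# `π ↦ Rπ`, `π ×ˢ A ↦ Φ.Win root A Rπ`, `tubeLData ↦ Skel.winLData`; companion of `SkelWinChainT`

builds on p205010 (kernel theorem, internal audit signed; external expert review pending) — nothing in this file uses p205010.
Status sentence (coordinator 2026-08-20T04:30Z): "θ(p_c) = 0 on ℤ^d, all d ≥ 2 — kernel-verified (Lean 4/Mathlib, standard axioms); internal adversarial
audit SIGNED 2026-08-20 04:29Z; external expert review pending."
Lane `prim-bschramm-*`, seat `prim-bschramm-stmt` (gen 7; port handed over by p2-g3 19:13:45Z); helper file (`--supports stmt-CriticalPhenomena-4575`).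
* `WinAdvData` (`Rπ`, start-box parameters `q q' s₁ ρ`, `R'`, `ℓ₀`, number of advance steps `nA`, axis `ax`, sign `sg`, centre `c`, `Rlev N j₀ j₁`,
  source = window centre `root`, support, rim parts); `alo/ahi/acore/aregion` (the straight-run boxes, planar, untouched), `stepL/stepD`, true target
  `coreT k = Win root core_{k+1} Rπ` (linked), enlarged target `coreE k = coreT k ∪ Rim k`, `stepA k : TStep (winGraph G root Rπ)`;
* `stepL_X`, `encl` (from `Adv.enlarge_core_subset_region`), `coreT_subset_stepD` (`Adv.core_succ_subset_region`), `stepD_subset_prism`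
  (`Adv.region_subset_prism`), `coreT_nonempty_of` (nonemptiness is a hypothesis at `kitsAt_stepA`: a core point needs a vertex above it within
  depth `Rπ`), `startBox_subset_X_zero`, `coreT_last_eq`, **`kitsAt_stepA`**.
[cite: KozmaNitzan2024, §4 Lemma 10 (p. 17), Lemma 11 (pp. 22–23)]
-/

noncomputable section

open MeasureTheory ProbabilityTheory
open scoped ENNReal

namespace Summit.CriticalPhenomena.PercolationContinuityZ3.Theorems

namespace Transplant

namespace Skel

open Literature.Probability.Percolation Literature.Probability.LatticeModels SimpleGraph
open Literature.Probability.Percolation.KozmaNitzan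
open KNLevels ChainPlanar

variable {V : Type} {G : SimpleGraph V} [G.LocallyFinite] (Φ : PlanarSkeletonConc G)

omit Φ in
/-- **The data of a straight-run chain in a window graph** (the window centre is the source). [cite: KozmaNitzan2024, §4 Lemma 11 (pp. 22–23)] -/
structure WinAdvData (V : Type) where
  /-- the window depth -/
  Rπ : ℕ
  /-- half-length of the start box along the axis -/
  q : ℤ
  /-- half-width of the start box -/
  q' : ℤ
  /-- the advance per step -/
  s₁ : ℤ
  /-- half-width of the prism containing all regions -/
  ρ : ℤ
  /-- the planar neighbourhood radius `R' ≥ Rlev + 1` -/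
  R' : ℕ
  /-- the minimal route scale -/
  ℓ₀ : ℕ
  /-- the number of advance steps after the start step -/
  nA : ℕ
  /-- the axis -/
  ax : Fin 2
  /-- the sign along the axis -/
  sg : ℤ
  /-- the centre of the start box -/
  c : Site 2
  /-- the level depth of every step -/
  Rlev : ℕ
  /-- the number of contacts demanded by Step II -/
  N : ℕ
  /-- the level window -/
  j₀ : ℕ
  /-- the level window -/
  j₁ : ℕ
  /-- the source (= the window centre) -/
  root : V
  /-- the finite support of the weighting -/
  Sfin : Finset V
  /-- the rim part of the enlarged target of step `k` -/
  Rim : ℕ → Finset V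

namespace WinAdvData

variable (P : WinAdvData V)

/-- Lower corner of core `k`. [folklore] -/
def alo (k : ℕ) : Site 2 := sLo P.ax P.sg P.c (Adv.coreα P.q P.s₁ k) (Adv.coreβ P.q P.s₁ k) (Adv.coreW P.q P.q' P.s₁ P.R' k)

/-- Upper corner of core `k`. [folklore] -/
def ahi (k : ℕ) : Site 2 := sHi P.ax P.sg P.c (Adv.coreα P.q P.s₁ k) (Adv.coreβ P.q P.s₁ k) (Adv.coreW P.q P.q' P.s₁ P.R' k)

/-- The planar core `k` of the straight run. [folklore] -/
def acore (k : ℕ) : Finset (Site 2) := Adv.core P.q P.q' P.s₁ P.R' P.ax P.sg P.c k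

/-- The planar region `k` of the straight run. [folklore] -/
def aregion (k : ℕ) : Finset (Site 2) := Adv.region P.q P.s₁ P.ρ P.ax P.sg P.c k

/-- **The level data of step `k`** (window levels of core `k`). [cite: KozmaNitzan2024, §4 Lemma 10 (p. 17)] -/
def stepL (k : ℕ) : LData (winGraph G P.root P.Rπ) := winLData Φ P.root P.Rπ (P.alo k) (P.ahi k) P.root P.Sfin

/-- **The region of step `k`**: `Win root region_k Rπ`. [cite: KozmaNitzan2024, §4 Lemma 10 (p. 17: D)] -/
def stepD (k : ℕ) : Finset V := Φ.Win P.root (P.aregion k) P.Rπ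

/-- **The true target of step `k`**: `Win root core_{k+1} Rπ`. [cite: KozmaNitzan2024, §4 Lemma 10 (p. 17: T)] -/
def coreT (k : ℕ) : Finset V := Φ.Win P.root (P.acore (k + 1)) P.Rπ

/-- **The enlarged target of step `k`.** [cite: KozmaNitzan2024, §4 p. 30] -/
def coreE [DecidableEq V] (k : ℕ) : Finset V := P.coreT Φ k ∪ P.Rim k

/-- **Step `k` as a target step** (enlarged target). [cite: KozmaNitzan2024, §4 Lemma 11 (pp. 22–23)] -/
def stepA [DecidableEq V] (k : ℕ) : TStep (winGraph G P.root P.Rπ) := ⟨P.stepL Φ k, P.stepD Φ k, P.coreE Φ k, P.Rlev, P.N, P.j₀, P.j₁⟩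

/-! ### The levels, the link, the containments -/

/-- **The levels of step `k`**: `Win root sBox(coreα k - j, coreβ k + j, coreW k + j) Rπ` (for a sign `sg = ±1`). [cite: KozmaNitzan2024, §4 p. 15 (B⟨j⟩)] -/
theorem stepL_X (hsg : P.sg = 1 ∨ P.sg = -1) (k j : ℕ) : (P.stepL Φ k).X j =
    Φ.Win P.root (sBox P.ax P.sg P.c (Adv.coreα P.q P.s₁ k - j) (Adv.coreβ P.q P.s₁ k + j) (Adv.coreW P.q P.q' P.s₁ P.R' k + j)) P.Rπ := by
  show winLevel Φ P.root P.Rπ (P.alo k) (P.ahi k) j = _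
  rw [winLevel, alo, ahi, sBox_enlarge _ _ hsg]

/-- The first level of step `k` is `Win root core_k Rπ`. [folklore] -/
theorem stepL_X_zero (hsg : P.sg = 1 ∨ P.sg = -1) (k : ℕ) : (P.stepL Φ k).X 0 = Φ.Win P.root (P.acore k) P.Rπ := by
  rw [P.stepL_X Φ hsg]; push_cast; simp only [sub_zero, add_zero]; rfl

/-- **The true targets link the chain**: `T'_k ⊆ X^{(k+1)}_0`. [cite: KozmaNitzan2024, §4 Lemma 12] -/
theorem coreT_subset_X_zero_succ [DecidableEq V] (hsg : P.sg = 1 ∨ P.sg = -1) (k : ℕ) : P.coreT Φ k ⊆ (P.stepA Φ (k + 1)).L.X 0 := by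
  show P.coreT Φ k ⊆ (P.stepL Φ (k + 1)).X 0
  rw [P.stepL_X_zero Φ hsg]; exact subset_rfl

/-- The true target lies in the enlarged target. [folklore] -/
theorem coreT_subset_coreE [DecidableEq V] (k : ℕ) : P.coreT Φ k ⊆ (P.stepA Φ k).T := Finset.subset_union_left

/-- The excess part of the enlarged target is inside the rim part. [folklore] -/
theorem coreE_sdiff_subset [DecidableEq V] (k : ℕ) : (P.stepA Φ k).T \ P.coreT Φ k ⊆ P.Rim k := by
  intro v hv
  rw [Finset.mem_sdiff] at hv
  rcases Finset.mem_union.1 hv.1 with h | h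
  · exact absurd h hv.2
  · exact h

/-- The sources agree. [folklore] -/
theorem stepA_o [DecidableEq V] (k : ℕ) : (P.stepA Φ k).L.o = P.root := rfl

/-- The targets. [folklore] -/
theorem stepA_T [DecidableEq V] (k : ℕ) : (P.stepA Φ k).T = P.coreE Φ k := rfl

/-- The regions. [folklore] -/
theorem stepA_D [DecidableEq V] (k : ℕ) : (P.stepA Φ k).D = P.stepD Φ k := rfl

variable {P}
variable (hsg : P.sg = 1 ∨ P.sg = -1) (hOK : Adv.AdvOK P.q P.q' P.s₁ P.ρ P.R' P.ℓ₀ P.nA)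
include hsg hOK

/-- **`X^{(k)}_{Rlev+1} ⊆ D_k`** when `Rlev + 1 ≤ R'` (`k ≤ nA`). [cite: KozmaNitzan2024, §4 Lemma 10 (p. 17: B⟨R+1⟩ ⊆ D)] -/
theorem encl (hRl : P.Rlev + 1 ≤ P.R') {k : ℕ} (hk : k ≤ P.nA) : (P.stepL Φ k).X (P.Rlev + 1) ⊆ P.stepD Φ k := by
  rw [P.stepL_X Φ hsg, stepD]
  refine Φ.Win_mono ((sBox_mono hsg _ ?_ ?_ ?_).trans (Adv.enlarge_core_subset_region hsg P.c hOK hk)) le_rfl <;> push_cast <;> omega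

/-- **`T'_k ⊆ D_k`** (`k ≤ nA`). [folklore] -/
theorem coreT_subset_stepD {k : ℕ} (hk : k ≤ P.nA) : P.coreT Φ k ⊆ P.stepD Φ k :=
  Φ.Win_mono (Adv.core_succ_subset_region hsg P.c hOK hk) le_rfl

/-- **`T_k ⊆ D_k`** when the rim part lies in the region. [folklore] -/
theorem coreE_subset_stepD [DecidableEq V] (hRim : ∀ k, P.Rim k ⊆ P.stepD Φ k) {k : ℕ} (hk : k ≤ P.nA) : P.coreE Φ k ⊆ P.stepD Φ k :=
  Finset.union_subset (coreT_subset_stepD Φ hsg hOK hk) (hRim k)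

/-- **`D_k` lies in the prism window `Win root {-ρ ≤ level ≤ q + (nA+1)s₁, |trans| ≤ ρ} Rπ`.** [cite: KozmaNitzan2024, §4 Lemma 11 (p. 22: Ω)] -/
theorem stepD_subset_prism {k : ℕ} (hk : k ≤ P.nA) :
    P.stepD Φ k ⊆ Φ.Win P.root (sBox P.ax P.sg P.c (-P.ρ) (P.q + ((P.nA : ℤ) + 1) * P.s₁) P.ρ) P.Rπ :=
  Φ.Win_mono (Adv.region_subset_prism hsg P.c hOK hk) le_rfl

/-- The planar core of every step is nonempty. [folklore] -/
theorem acore_nonempty (k : ℕ) : (P.acore k).Nonempty := Adv.core_nonempty hsg P.c hOK k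

omit hsg hOK in
/-- **`T'_k` is nonempty** as soon as some vertex of depth `≤ Rπ` has its footprint in the core. [folklore] -/
theorem coreT_nonempty_of {k : ℕ} {v : V} (hv : v ∈ Literature.Barriers.CriticalPhenomena.graphBall G P.root P.Rπ)
    (hφ : Φ.φ v ∈ P.acore (k + 1)) : (P.coreT Φ k).Nonempty :=
  ⟨v, Φ.mem_Win.2 ⟨hv, hφ⟩⟩

omit hOK in
/-- **The start box lies in the first level**: `Win root {|level| ≤ q, |trans| ≤ q'} R₀ ⊆ X^{(0)}_0` for `R₀ ≤ Rπ`. [folklore] -/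
theorem startBox_subset_X_zero {R₀ : ℕ} (hR₀ : R₀ ≤ P.Rπ) : Φ.Win P.root (sBox P.ax P.sg P.c (-P.q) P.q P.q') R₀ ⊆ (P.stepL Φ 0).X 0 := by
  rw [P.stepL_X_zero Φ hsg]
  refine Φ.Win_mono (le_of_eq ?_) hR₀
  rw [acore, (Adv.core_zero_last (q := P.q) (q' := P.q') (s₁ := P.s₁) (R' := P.R') (N := P.nA) (a := P.ax) (σ := P.sg) (c := P.c)).1]

omit hsg hOK in
/-- **The last true target is the far face**: `Win root {level = q + (nA+1)s₁, |trans| ≤ w₁ + nA·R'} Rπ`. [cite: KozmaNitzan2024, §4 Lemma 11] -/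
theorem coreT_last_eq : P.coreT Φ P.nA =
    Φ.Win P.root (sBox P.ax P.sg P.c (P.q + ((P.nA : ℤ) + 1) * P.s₁) (P.q + ((P.nA : ℤ) + 1) * P.s₁)
      (Adv.w₁ P.q P.q' P.s₁ P.R' + (P.nA : ℤ) * P.R')) P.Rπ := by
  rw [coreT, acore, (Adv.core_zero_last (q := P.q) (q' := P.q') (s₁ := P.s₁) (R' := P.R') (N := P.nA) (a := P.ax) (σ := P.sg) (c := P.c)).2]

/-! ### The kits -/

/-- **`KitsAt` of the enlarged step `k`** (`k ≤ nA`) from a subbox region in the window graph, finite support, the source off the region, a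
nonempty true target, the count inequality and the per-level kit clause towards the enlarged target. [cite: KozmaNitzan2024, §4 Lemma 10 (p. 17)] -/
theorem kitsAt_stepA [DecidableEq V] (hRl : P.Rlev + 1 ≤ P.R') (hRim : ∀ k, P.Rim k ⊆ P.stepD Φ k) {k : ℕ} (hk : k ≤ P.nA)
    (hTne : (P.coreT Φ k).Nonempty) {Wt : Sym2 V → unitInterval} {p : unitInterval} {Δ : ℕ} {δ : ℝ}
    (hsub : KNLevels.IsSubbox (winGraph G P.root P.Rπ) Wt p (P.stepD Φ k)) (hfin : FinSupp Wt P.Sfin) (hDS : P.stepD Φ k ⊆ P.Sfin)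
    (ho : P.root ∉ P.stepD Φ k) (hoS : P.root ∈ P.Sfin) (hj : P.j₁ ≤ P.Rlev)
    (hcount : 1 / (1 - (p : ℝ)) ^ (Δ * P.N) ≤ δ * ((Finset.Icc P.j₀ P.j₁).card : ℝ))
    (hkits : ∀ j ∈ Finset.Icc P.j₀ P.j₁, ∃ (σ : SData V) (S : Finset V),
      SHyp (winLData Φ P.root P.Rπ (P.alo k) (P.ahi k) P.root P.Sfin) j σ ∧ σ.N ≤ P.N ∧
      (1 - (p : ℝ) ^ σ.sB) ^ σ.k ≤ δ ∧ S ⊆ (winLData Φ P.root P.Rπ (P.alo k) (P.ahi k) P.root P.Sfin).X j ∧ S ⊆ P.stepD Φ k ∧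
      (∀ x ∈ σ.K, ∀ e ∈ σ.seed x, e ∉ wireSet (↑S : Set V)) ∧ (∀ x ∈ σ.K, σ.face x ⊆ S) ∧
      (∀ x ∈ σ.K, 1 - 3 * δ ≤ (prodBernoulli Wt).real {ω | ∃ u ∈ σ.face x,
        1 - δ < (prodBernoulli (pinW Wt (wireSet (↑S : Set V)) ω)).real
          (⋃ t ∈ P.coreE Φ k, openConnIn (↑(P.stepD Φ k) : Set V) u t)})) :
    (P.stepA Φ k).KitsAt Wt p Δ δ := by
  -- `Skel.lhyp_win` is stated with the classical `DecidableEq` instance (L5.1); bridge by subsingleton-ness of instances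
  have hL := lhyp_win Φ P.root P.Rπ (P.alo k) (P.ahi k) (Wt := Wt) (p := p) (D := P.stepD Φ k) (Rl := P.Rlev) (o := P.root)
    (Sfin := P.Sfin) (by convert hsub) hfin hDS (encl Φ hsg hOK hRl hk) ho hoS
  refine ⟨?_, hj, coreE_subset_stepD Φ hsg hOK hRim hk, hTne.mono (P.coreT_subset_coreE Φ k), hcount, hkits⟩
  convert hL using 1 <;> rfl

end WinAdvData

end Skel

end Transplant

end Summit.CriticalPhenomena.PercolationContinuityZ3.Theorems

end
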